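import Summits.HodgeConjecture.HodgeConjecture.Theorems.HeckePrymWeilHeckePrymAnchorsOfPeriodConstruction
import Summits.HodgeConjecture.HodgeConjecture.Theorems.HeckePrymWeilHeckePrymAnchorsOfAlgebraicAnchor
import HarnessLib

/-!
# `HeckePrymAnchors` from Deligne's period construction ALONE (item stmt-HodgeConjecture-14496, route HeckePrymWeil)

Line `Sketch`, continuation lead c34 — the RIEMANN-FREE CLOSURE of the crux, composed. The
algebraic-anchor form of Deligne's family package (hypothesis of `heckePrymAnchors_of_kActionAlg`,
`Theorems/HeckePrymWeilHeckePrymAnchorsOfAlgebraicAnchor`) is the common weakening of both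
renderings of the line's one stub:

* `kActionAlg_of_kAction` — the named fact `deligne1982_weilFamily_kAction` (⟺ route item
  `DeligneWeilFamily`, stmt-HodgeConjecture-16866, `deligneWeilFamilyDecl_iff_kAction`) ⟹ the
  algebraic-anchor form: its tensor-isogeny clause at `s₀` gives an algebraic strong Weil plane by the
  landed `owf_anchorAlgebraic` (Deligne's Lemma 4.5 across the isogeny pair);
* `heckePrymAnchors_of_periodConstruction` — **[U] ⟹ `HeckePrymAnchors`**: Deligne's period
  construction ALONE (hypothesis `h` of
  `deligne1982_weilFamily_levelStructure_of_periodConstruction`, verbatim) implies the crux, by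
  `kActionAlg_of_periodConstruction` (`Theorems/HeckePrymWeilHeckePrymAnchorsOfPeriodConstruction`:
  Lefschetz `(1,1)` at the diagonal CM fibre instead of Riemann's theorem) and
  `heckePrymAnchors_of_kActionAlg`.

So the residual of THIS crux is [U] alone, while item 16866 as filed needs [U] ∧ [F]
([F] = fullness / Riemann, `HodgeTheory/AbelianVarietyHodgeHomFullness`). No definition, no `sorry`.
-/

noncomputable section

-- every declaration of this problem lives in `Summit.HodgeConjecture.HodgeConjecture.…` (summit = sub-problem)
set_option linter.dupNamespace false

open CategoryTheory AlgebraicGeometry Limits MonoidalCategory CartesianMonoidalCategory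
open Literature.AlgebraicTopology.SingularHomology
open scoped TensorProduct

namespace Summit.HodgeConjecture.HodgeConjecture.Theorems.HeckePrymWeilLine

open Literature.AlgebraicGeometry Literature.AlgebraicGeometry.Motives Literature.AlgebraicGeometry.HodgeTheory
open Summit.HodgeConjecture.HodgeConjecture.Theses.HeckePrymWeil

/-- **The algebraic-anchor form from Deligne's family with `K`-action** (the named fact
`deligne1982_weilFamily_kAction`, equivalent to the route item `DeligneWeilFamily`,
stmt-HodgeConjecture-16866): the family, global `√-p`, charts and continuous section are passed
through unchanged, and the tensor-isogeny clause at `s₀` — an isogeny pair `Y ⇄ A₁ × A₁` intertwining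
`Ψ` with the companion `(x, y) ↦ (-p·y, x)` — yields `weilClassesOf Y Ψ k p ≤ algebraicClasses Y.X k`
by `owf_anchorAlgebraic` (Deligne's Lemma 4.5: on a tensor point the strong Weil plane is spanned by
products of pulled-back point classes, moved across the isogeny pair). So the algebraic-anchor form
consumed by `heckePrymAnchors_of_kActionAlg` is implied by EITHER rendering: item 16866 (this
theorem) or the period construction [U] alone (`kActionAlg_of_periodConstruction`).
[cite: Deligne1982HodgeCycles, proof of Thm. 4.8 (pp. 47–52), Lemma 4.5, Remark 4.10]
[cite: vanGeemen1994HodgeAV, 3.6–3.7, 5.3–5.11] -/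
theorem kActionAlg_of_kAction :
    Literature.AlgebraicGeometry.HodgeTheory.deligne1982_weilFamily_kAction → ∀ p : ℕ, p.Prime → p % 4 = 3 → 7 ≤ p → ∀ (k : ℕ), 1 ≤ k → ∀ (X : AbelianVariety ℂ) (Φ : X ⟶ X), X.dim = 2 * k → Φ ≫ Φ = -((p : ℤ) • 𝟙 X) → ∀ c : complexBetti X.X (2 * k), c ∈ weilClassesOf X Φ k p → c ≠ 0 → IsRationalClass c → IsOfHodgeType (2 * k) X.X (2 * k) k k c → ∃ (𝒳 S : SchemeOver ℂ) (f : 𝒳 ⟶ S) (g : 𝒳 ⟶ 𝒳) (s₁ s₀ : ComplexPoints S) (e : X.X ≅ fiberOver f s₁) (σ : ComplexPoints S → FiberClass f (2 * k)), IsSmoothProjectiveFamily f (2 * k) ∧ (∃ (N : ℕ) (ι : 𝒳 ⟶ projectiveSpace N ℂ ⊗ S), IsClosedImmersion ι.left ∧ ι ≫ snd (projectiveSpace N ℂ) S = f) ∧ IrreducibleSpace S.left ∧ AlgebraicGeometry.Smooth S.hom ∧ IsQuasiProjectiveOver S ∧ g ≫ f = f ∧ (∀ s : ComplexPoints S, ∃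 (A' : AbelianVariety ℂ) (φ' : A' ⟶ A') (e' : A'.X ≅ fiberOver f s), A'.dim = 2 * k ∧ φ' ≫ φ' = -((p : ℤ) • 𝟙 A') ∧ (e'.hom ≫ fiberι f s) ≫ g = φ'.hom.hom.hom ≫ (e'.hom ≫ fiberι f s)) ∧ (e.hom ≫ fiberι f s₁) ≫ g = Φ.hom.hom.hom ≫ (e.hom ≫ fiberι f s₁) ∧ Continuous σ ∧ (∀ s, (σ s).pt = s) ∧ σ s₁ = ⟨s₁, complexBetti.map e.inv (2 * k) c⟩ ∧ ∃ (Y : AbelianVariety ℂ) (Ψ : Y ⟶ Y) (e₀ : Y.X ≅ fiberOver f s₀), weilClassesOf Y Ψ k p ≤ algebraicClasses Y.X k ∧ (e₀.hom ≫ fiberι f s₀) ≫ g = Ψ.hom.hom.hom ≫ (e₀.hom ≫ fiberι f s₀) := by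
  intro h p hp hp4 hp7 k hk X Φ hX hΦ c hc hc0 hrat hH
  obtain ⟨𝒳, S, f, g, s₁, s₀, e, σ, hfam, hemb, hirr, hsm, hSqp, hg, hfib, he, hσ, hpt, hσ₁, Y, Ψ, e₀,
    ⟨A₁, f₁, g₁, m, hA₁, hY, hΨ, hm, hfg, hf, hg₁⟩, he₀⟩ := h p hp hp4 hp7 k hk X Φ hX hΦ c hc hc0 hrat hH
  exact ⟨𝒳, S, f, g, s₁, s₀, e, σ, hfam, hemb, hirr, hsm, hSqp, hg, hfib, he, hσ, hpt, hσ₁, Y, Ψ, e₀,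
    owf_anchorAlgebraic hp hp4 hp7 A₁ f₁ g₁ m hA₁ hY hΨ hm hfg hf hg₁, he₀⟩

/-- **`HeckePrymAnchors` from Deligne's period construction alone** (the Riemann-free closure of the
crux of line `Sketch`): [U] — for every complex abelian `2n`-fold `(P, ψ₀)` with `ψ₀ ≫ ψ₀ = -d`, a
smooth projective family through `P` over a smooth irreducible quasi-projective base embedded in
`ℙᴺ × S`, with its global `√-d` and fibre charts, a level-`n'` structure at the base point and period
surjectivity onto `X⁺(D_P)` ([Deligne1982HodgeCycles], proof of Thm. 4.8, pp. 48–51: `Γ\B → Γ\X⁺`;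
Baily–Borel and Borel; [MumfordFogartyKirwan1994, Thm. 7.9]) — implies the crux `HeckePrymAnchors`,
by `kActionAlg_of_periodConstruction` and the landed `heckePrymAnchors_of_kActionAlg`. Compared with the
registered stub `DeligneWeilFamily` (item stmt-HodgeConjecture-16866 ⟸ [U] ∧ [F] in the tree), the
fullness / Riemann hypothesis [F] is gone.
[cite: Deligne1982HodgeCycles, proof of Thm. 4.8 (pp. 47–52) with Prop. 4.4 and Lemma 4.5]
[cite: vanGeemen1994HodgeAV, 5.3–5.11] [cite: MumfordFogartyKirwan1994, Thm. 7.9–7.10] -/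
theorem heckePrymAnchors_of_periodConstruction :
    (∀ (n d : ℕ), 1 ≤ n → 1 ≤ d → ∀ (P : AbelianVariety ℂ) (ψ₀ : P ⟶ P) (e : ProjectiveEmbedding P.X) (a : complexBetti (projectiveSpace e.n ℂ) 2), P.dim = 2 * n → ψ₀ ≫ ψ₀ = -((d : ℤ) • 𝟙 P) → ∀ (ha : IsRationalClass a) (ha0 : a ≠ 0), ∃ (𝒳 S : SchemeOver ℂ) (f : 𝒳 ⟶ S) (g : 𝒳 ⟶ 𝒳) (s₀ : ComplexPoints S) (e' : P.X ≅ fiberOver f s₀) (Y : ComplexPoints S → AbelianVariety ℂ) (Ψ : ∀ s, Y s ⟶ Y s) (ε : ∀ s, (Y s).X ≅ fiberOver f s) (N : ℕ) (ι : 𝒳 ⟶ CategoryTheory.MonoidalCategoryStruct.tensorObj (projectiveSpace N ℂ) S), IsSmoothProjectiveFamily f (2 * n) ∧ AlgebraicGeometry.IsClosedImmersion ι.left ∧ ι ≫ CategoryTheory.CartesianMonoidalCategory.snd (projectiveSpace N ℂ) S = f ∧ IrreducibleSpace S.left ∧ AlgebraicGeometry.Smooth S.hom ∧ IsQuasiProjectiveOver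 S ∧ g ≫ f = f ∧ (e'.hom ≫ fiberι f s₀) ≫ g = ψ₀.hom.hom.hom ≫ (e'.hom ≫ fiberι f s₀) ∧ (∀ s, (Y s).dim = 2 * n ∧ Ψ s ≫ Ψ s = -((d : ℤ) • 𝟙 (Y s)) ∧ ((ε s).hom ≫ fiberι f s) ≫ g = (Ψ s).hom.hom.hom ≫ ((ε s).hom ≫ fiberι f s)) ∧ (∃ (ιb : Type) (_ : Fintype ιb) (_ : DecidableEq ιb) (b : Module.Basis ιb ℂ (complexBetti (fiberOver f s₀) 1)) (Jℤ : Matrix ιb ιb ℤ) (n' : ℕ), 3 ≤ n' ∧ (∀ g₀ : fiberOver f s₀ ⟶ fiberOver f s₀, g₀ ≫ fiberι f s₀ = fiberι f s₀ ≫ g → LinearMap.toMatrix b b (complexBetti.map g₀ 1).hom = Jℤ.map (Int.castRingHom ℂ)) ∧ ∀ (hU : IsCohomologicallyLocallyTrivialOn f (Set.univ : Set (ComplexPoints S))) (γ : Path.Homotopic.Quotient (⟨s₀, Set.mem_univ s₀⟩ : (Set.univ : Set (ComplexPoints S))) ⟨s₀, Set.mem_univ s₀⟩), ∃ Dℤ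 : Matrix ιb ιb ℤ, LinearMap.toMatrix b b (transportLinear f 1 hU γ :) = (1 + (n' : ℤ) • Dℤ).map (Int.castRingHom ℂ)) ∧ ∃ (m : ℕ) (hm : 1 ≤ m) (hPm : P.dim = m + 1) (hd : 0 < d) (hψ : ψ₀ ≫ ψ₀ = -(d • 𝟙 P)) (ω : complexBetti P.X (2 + 2 * m)) (hω : IsRationalClass ω) (hω0 : ω ≠ 0), ∀ (J : (weilDatumOfKsymm hm hPm hd hψ e ha ha0 hω hω0).Cx →ₗ[ℂ] (weilDatumOfKsymm hm hPm hd hψ e ha ha0 hω hω0).Cx) (hW : Motives.IsWeilComplexStructure (weilDatumOfKsymm hm hPm hd hψ e ha ha0 hω hω0).hForm J), ∃ (s : ComplexPoints S) (β : bettiCohomology P.X 1 ≃ₗ[ℚ] bettiCohomology (Y s).X 1), (∀ x, β (bettiCohomology.map ψ₀.hom.hom.hom 1 x) = bettiCohomology.map (Ψ s).hom.hom.hom 1 (β x)) ∧ ∀ x ∈ ((weilDatumOfKsymm hm hPm hd hψ e ha ha0 hω hω0).hodgeStructure J hW.sq).piece 1 0, IsOfHodgeType (2 * n) (Y s).X 1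 1 0 (Motives.ofRatClassBaseChange (ComplexPoints (Y s).X) 1 (β.toLinearMap.baseChange ℂ x))) → Summit.HodgeConjecture.HodgeConjecture.Theses.HeckePrymWeil.HeckePrymAnchors :=
  fun h => heckePrymAnchors_of_kActionAlg (kActionAlg_of_periodConstruction h)

end Summit.HodgeConjecture.HodgeConjecture.Theorems.HeckePrymWeilLine

end
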